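import Summits.QuantumFields.QCD.Theses.SpectralDefectExtinction
import Summits.QuantumFields.QCD.Theorems.SpectralDefectExtinctionWindowExtinctionCornerFlatMassOnResonant
import Summits.QuantumFields.QCD.Theorems.SpectralDefectExtinctionWindowExtinctionCornerDenseBoxOfMass
import Summits.QuantumFields.QCD.Theorems.SpectralDefectExtinctionWindowExtinctionCornerResonanceLD
import Summits.QuantumFields.QCD.Theorems.SpectralDefectExtinctionWindowExtinctionCornerTwoLineAssembly

/-!
# S2 `stub_twoLineDecay` of line `corner-decorrelation-deep-hole` reduced to S2c BY NAME
(crux `Summit.QuantumFields.QCD.Theses.SpectralDefectExtinction.WindowExtinction`, item stmt-QuantumFields-18063)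

Helper (supports the crux item; does not close a registered stub): with S2a (`stub_flatMassOnResonant`), S2b
(`stub_denseBoxOfMass`), S2d (`stub_resonanceLD`) and S2e (`stub_twoLineAssembly`) landed, the lever S2
(two-line decay, registered stub `stub_twoLineDecay`) follows from the single remaining probabilistic input S2c
(`stub_singleLinkResonance`, single-link resonance anti-concentration) by composition:
`twoLineDecay_of_singleLinkResonance h = stub_twoLineAssembly cornerTL_flatDenseBox (stub_resonanceLD h)`.
`cornerTL_flatDenseBox` is the skeleton's deterministic glue DET (flat column supported in a ball ⇒ dense
grid-resonant box nearby: S2a + S2b + pigeonhole over the four grid phases).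
-/

noncomputable section

namespace Summit.QuantumFields.QCD.Cruxes.WindowExtinction.CornerDecorrelationDeepHole

open scoped BigOperators Topology Classical Matrix
open Filter MeasureTheory
open Literature.MathematicalPhysics.QuantumLattice Literature.MathematicalPhysics.QuantumFieldTheory
  Literature.Probability.LatticeModels
open Summit.QuantumFields.QCD.Theses.SpectralDefectExtinction

/-- **DET (glue): flat column in a ball ⇒ a dense grid-resonant box nearby**, from the landed S2a
(`stub_flatMassOnResonant`) + S2b (`stub_denseBoxOfMass`) and a pigeonhole over the four grid phases (the
skeleton's `flatDenseBox_of_stubs`, landed here so that S2 reduces to S2c by name). -/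
theorem cornerTL_flatDenseBox :
    ∀ (L : ℕ) [NeZero L] (U : GaugeConfig 4 L SU3) (θ : ℝ) (ℓ n : ℕ) (x : TorusSite 4 L) (ψ : QuarkIdx L → ℂ),
    0 < θ → 2 ≤ ℓ → 2 * ℓ ≤ L → (ℓ : ℝ) ^ 2 * θ ≤ 1 / 4096 →
    (∀ p, ψ p ≠ 0 → ∃ v ∈ box 4 n, p.1 = x + Torus.proj L v) →
    0 < ∑ p, ‖ψ p‖ ^ 2 →
    4 * (1 - θ) * (∑ p, ‖ψ p‖ ^ 2) ≤
    ‖∑ p, star (ψ p) * ((∑ μ, wilsonHop (fundamentalRep (Fin 3)) U μ) *ᵥ ψ) p‖ →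
    ∃ k : ℤ, (|k| : ℝ) ≤ Real.pi / Real.sqrt (512 * θ) + 1 ∧
    ∃ a : Fin 4 → ℤ, (∀ i, ((x i).val : ℤ) - n - 2 * ℓ ≤ a i ∧ a i ≤ ((x i).val : ℤ) + n + 1) ∧
    ∃ m : Fin 4 → ℕ, (∀ i, ℓ ≤ m i ∧ m i < 2 * ℓ) ∧
    (∏ i, m i) ≤ 16 * ((Fintype.piFinset fun i => Finset.Ico (a i) (a i + m i)).filter
    (fun v => 1 ≤ Multiset.countP
    (fun w : ℂ => ‖w - Complex.exp (↑((k : ℝ) * Real.sqrt (512 * θ)) * Complex.I)‖ ≤ Real.sqrt (2048 * θ))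
    (fundamentalRep (Fin 3) (plaquetteHolonomy U (Torus.proj L v) 0 1)).charpoly.roots)).card := by
  have h1 := stub_flatMassOnResonant
  have h2 := stub_denseBoxOfMass
  intro L _ U θ ℓ n x ψ hθ hℓ h2ℓ hℓθ hsupp hpos hflat
  obtain ⟨henergy, k, hk, hmass⟩ := h1 L U θ ψ hθ hflat
  -- shifted site norm
  let e : TorusSite 4 L := Pi.single 0 1 + Pi.single 1 1
  let f : TorusSite 4 L → ℝ := fun y => Real.sqrt (∑ a, ∑ s, ‖ψ (y, a, s)‖ ^ 2)
  let g : TorusSite 4 L → ℝ := fun y => f (y + e)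
  have hgdef : ∀ y, g y = f (y + e) := fun _ => rfl
  have hf2 : ∀ y, f y ^ 2 = ∑ a, ∑ s, ‖ψ (y, a, s)‖ ^ 2 := fun y =>
    Real.sq_sqrt (by positivity)
  have hsumf : ∑ y, f y ^ 2 = ∑ p, ‖ψ p‖ ^ 2 := by
    simp_rw [hf2]
    rw [Fintype.sum_prod_type]
    refine Finset.sum_congr rfl fun y _ => ?_
    rw [Fintype.sum_prod_type]
  have hshift : ∀ (F : TorusSite 4 L → ℝ), ∑ y, F (y + e) = ∑ y, F y := fun F =>
    Fintype.sum_equiv (Equiv.addRight e) _ _ fun y => rfl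
  have hsumg : ∑ y, g y ^ 2 = ∑ p, ‖ψ p‖ ^ 2 := by
    rw [← hsumf]; exact hshift (fun y => f y ^ 2)
  let A : TorusSite 4 L → Prop := fun y => ∃ i : Fin 4, 1 ≤ Multiset.countP
      (fun w : ℂ => ‖w - Complex.exp (↑((k i : ℝ) * Real.sqrt (512 * θ)) * Complex.I)‖ ≤ Real.sqrt (2048 * θ))
      (fundamentalRep (Fin 3) (plaquetteHolonomy U y 0 1)).charpoly.roots
  have hg0 : ∀ y, 0 ≤ g y := fun y => Real.sqrt_nonneg _
  have hgpos : 0 < ∑ y, g y ^ 2 := by rw [hsumg]; exact hpos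
  have hη : (ℓ : ℝ) ^ 2 * (32 * θ) ≤ 1 / 128 := by nlinarith
  have hproj_e : Torus.proj L ((Pi.single 0 1 : Fin 4 → ℤ) + Pi.single 1 1) = e := by
    ext i
    simp only [Torus.proj, Pi.add_apply, Pi.single_apply, Int.cast_add, e]
    split_ifs <;> simp
  have hsuppg : ∀ y, g y ≠ 0 → ∃ v ∈ box 4 (n + 1), y = x + Torus.proj L v := by
    intro y hy
    have hne : (∑ a, ∑ s, ‖ψ (y + e, a, s)‖ ^ 2) ≠ 0 := by
      intro h0; apply hy; show Real.sqrt _ = 0; rw [h0, Real.sqrt_zero]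
    obtain ⟨a, -, ha⟩ := Finset.exists_ne_zero_of_sum_ne_zero hne
    obtain ⟨s, -, hs⟩ := Finset.exists_ne_zero_of_sum_ne_zero ha
    have hψ : ψ (y + e, a, s) ≠ 0 := by
      intro h0; apply hs; rw [h0, norm_zero]; norm_num
    obtain ⟨v, hv, hyv⟩ := hsupp _ hψ
    refine ⟨v - (Pi.single 0 1 + Pi.single 1 1), ?_, ?_⟩
    · rw [mem_box] at hv ⊢
      intro i
      have := hv i
      simp only [Pi.sub_apply, Pi.add_apply, Pi.single_apply]
      push_cast
      split_ifs <;> constructor <;> omega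
    · have hy' : y = x + Torus.proj L v - e := eq_sub_of_add_eq hyv
      have hps : Torus.proj L (v - (Pi.single 0 1 + Pi.single 1 1)) =
          Torus.proj L v - Torus.proj L ((Pi.single 0 1 : Fin 4 → ℤ) + Pi.single 1 1) := by
        ext i; simp [Torus.proj, Int.cast_sub]
      rw [hy', hps, hproj_e]
      abel
  have henergyg : (∑ y, ∑ μ : Fin 4, (g y - g (y + Pi.single μ 1)) ^ 2) ≤ 32 * θ * ∑ y, g y ^ 2 := by
    rw [hsumg]
    have heq : (∑ y, ∑ μ : Fin 4, (g y - g (y + Pi.single μ 1)) ^ 2) =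
        ∑ y, ∑ μ : Fin 4, (f y - f (y + Pi.single μ 1)) ^ 2 := by
      refine Fintype.sum_equiv (Equiv.addRight e) _ _ fun y => ?_
      refine Finset.sum_congr rfl fun μ _ => ?_
      simp only [hgdef, Equiv.coe_addRight, add_right_comm y e]
    rw [heq]
    exact henergy
  have hmassg : 3 / 4 * (∑ y, g y ^ 2) ≤ ∑ y ∈ (Finset.univ : Finset (TorusSite 4 L)).filter (fun y => A y), g y ^ 2 := by
    rw [hsumg]
    refine hmass.trans (le_of_eq ?_)
    refine Finset.sum_congr rfl fun y _ => ?_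
    rw [hgdef, hf2 (y + e), add_assoc]
  obtain ⟨a, ha, m, hm, hdense⟩ :=
    h2 L g A (32 * θ) ℓ n x hg0 hgpos hℓ h2ℓ (by positivity) hη hsuppg henergyg (by convert hmassg using 4)
  -- pigeonhole over the four grid phases
  let B : Finset (Fin 4 → ℤ) := Fintype.piFinset fun i => Finset.Ico (a i) (a i + m i)
  let P : Fin 4 → (Fin 4 → ℤ) → Prop := fun i v => 1 ≤ Multiset.countP
      (fun w : ℂ => ‖w - Complex.exp (↑((k i : ℝ) * Real.sqrt (512 * θ)) * Complex.I)‖ ≤ Real.sqrt (2048 * θ))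
      (fundamentalRep (Fin 3) (plaquetteHolonomy U (Torus.proj L v) 0 1)).charpoly.roots
  have hdense' : (∏ i, m i) ≤ 4 * (B.filter (fun v => A (Torus.proj L v))).card := by
    convert hdense using 4
  have hsub : B.filter (fun v => A (Torus.proj L v)) ⊆ (Finset.univ : Finset (Fin 4)).biUnion (fun i => B.filter (P i)) := by
    intro v hv
    rw [Finset.mem_filter] at hv
    obtain ⟨hvB, i, hi⟩ := hv
    exact Finset.mem_biUnion.2 ⟨i, Finset.mem_univ _, Finset.mem_filter.2 ⟨hvB, hi⟩⟩
  have hcard : (B.filter (fun v => A (Torus.proj L v))).card ≤ ∑ i, (B.filter (P i)).card :=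
    (Finset.card_le_card hsub).trans Finset.card_biUnion_le
  have hex : ∃ i : Fin 4, (∏ i, m i) ≤ 16 * (B.filter (P i)).card := by
    by_contra hcon
    push Not at hcon
    have hlt : ∑ i : Fin 4, 16 * (B.filter (P i)).card < ∑ _i : Fin 4, ∏ i, m i :=
      Finset.sum_lt_sum_of_nonempty Finset.univ_nonempty fun i _ => hcon i
    rw [Finset.sum_const, Finset.card_univ, Fintype.card_fin, smul_eq_mul, ← Finset.mul_sum] at hlt
    omega
  obtain ⟨i, hi⟩ := hex
  exact ⟨k i, hk i, a, ha, m, hm, hi⟩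



/-- **S2 from S2c by name.**  The single-link resonance anti-concentration S2c (`stub_singleLinkResonance`,
integrated product-Haar form) implies the TWO-LINE DECAY S2 (registered stub `stub_twoLineDecay`): there are
`c₁, C, C₀ > 0` such that for `N_f ≤ 3`, `β ≥ 1`, odd tori `2S+1 ≥ C₀√β`, masses `μ_f ≥ −1` and `1 ≤ n ≤ β³` the
`∏_f|det D_W(U,μ_f,1)|`-weighted Wilson mean of `‖(4·1 − D_W(U,0,1))ⁿ‖_F²` is `≤ C (2S+1)⁴ (4 − c₁/β)^{2n}`. -/
theorem twoLineDecay_of_singleLinkResonance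
    (hSL : ∃ C : ℝ, 0 < C ∧ ∀ Nf : ℕ, Nf ≤ 3 → ∀ β : ℝ, 1 ≤ β → ∀ (L : ℕ) [NeZero L], 2 ≤ L →
    ∀ (μ : Fin Nf → ℝ) (z : TorusSite 4 L) (φ₀ ε : ℝ), 0 < ε → ε ≤ 1 →
    ∀ (G : GaugeConfig 4 L SU3 → ℝ) (B : ℝ), Measurable G → (∀ U, 0 ≤ G U ∧ G U ≤ B) →
    (∀ (U : GaugeConfig 4 L SU3) (g : SU3), G (Function.update U (z, 0) g) = G U) →
    ∫ U, G U * (if 1 ≤ Multiset.countP (fun w : ℂ => ‖w - Complex.exp (↑φ₀ * Complex.I)‖ ≤ ε)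
    (fundamentalRep (Fin 3) (plaquetteHolonomy U z 0 1)).charpoly.roots then (1 : ℝ) else 0) *
    (Real.exp (-(β * wilsonAction (fundamentalRep (Fin 3)) U)) *
    ∏ f, ‖fermionDet (wilsonDirac (fundamentalRep (Fin 3)) U (μ f) 1)‖)
    ∂(Measure.pi fun _ : Edge 4 L => haarProbability SU3) ≤
    C * Real.sqrt β * ε *
    ∫ U, G U * (Real.exp (-(β * wilsonAction (fundamentalRep (Fin 3)) U)) *
    ∏ f, ‖fermionDet (wilsonDirac (fundamentalRep (Fin 3)) U (μ f) 1)‖)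
    ∂(Measure.pi fun _ : Edge 4 L => haarProbability SU3)) :
    ∃ c₁ C C₀ : ℝ, 0 < c₁ ∧ 0 < C ∧ 0 < C₀ ∧ ∀ Nf : ℕ, Nf ≤ 3 → ∀ β : ℝ, 1 ≤ β → ∀ S : ℕ, C₀ * Real.sqrt β ≤ 2 * S + 1 → ∀ μ : Fin Nf → ℝ, (∀ f, -1 ≤ μ f) → ∀ n : ℕ, 1 ≤ n → (n : ℝ) ≤ β ^ 3 → (∫ U : GaugeConfig 4 (2 * S + 1) ↥(Matrix.specialUnitaryGroup (Fin 3) ℂ), (∑ i, ∑ j, ‖(((4 : ℂ) • (1 : Matrix (QuarkIdx (2 * S + 1)) (QuarkIdx (2 * S + 1)) ℂ) - wilsonDirac (fundamentalRep (Fin 3)) U 0 1) ^ n) i j‖ ^ 2) * ∏ f : Fin Nf, ‖fermionDet (wilsonDirac (fundamentalRep (Fin 3)) U (μ f) 1)‖ ∂(wilsonMeasure (fundamentalRep (Fin 3)) β)) / (∫ U : GaugeConfig 4 (2 * S + 1) ↥(Matrix.specialUnitaryGroup (Fin 3) ℂ), ∏ f : Fin Nf, ‖fermionDet (wilsonDirac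 (fundamentalRep (Fin 3)) U (μ f) 1)‖ ∂(wilsonMeasure (fundamentalRep (Fin 3)) β)) ≤ C * (2 * S + 1 : ℝ) ^ 4 * (4 - c₁ / β) ^ (2 * n) :=
  stub_twoLineAssembly cornerTL_flatDenseBox (stub_resonanceLD hSL)

end Summit.QuantumFields.QCD.Cruxes.WindowExtinction.CornerDecorrelationDeepHole

end
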